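import Literature.AlgebraicGeometry.Frobenioids.Thm49TwinPrimaryLemmas
import Literature.AlgebraicGeometry.Frobenioids.BirationalizationBiratData
import Literature.AlgebraicGeometry.Frobenioids.TwinPrimaryTransport
import HarnessLib

/-!
# [FrdI] Theorem 4.9, proof p. 90 ll. 5–27: EXISTENCE of the twin-primary pair of Proposition 4.1 (iii)
# squares at a prime, from a birational germ witnessing strict rationality (sub-DAG S5, row T49-L07)

Mochizuki, *The geometry of Frobenioids I: the general theory*, Kyushu J. Math. **62** (2008)
293–400, §4, proof of Theorem 4.9, kurims text p. 90 ll. 5–27 [cite: MochizukiFrdI2008, Thm. 4.9 p.90]: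

> "since `A` is strictly rational, it follows [cf. Definition 4.5, (ii)] that there exist, for each
> `𝔭 ∈ Prime(Φ_i(A))`, cartesian commutative diagrams of pre-steps as in Proposition 4.1, (iii),
> [`C →γ' D`, `γ : C → B`, `δ : D → A`, `β : B → A`] and [`C →γ' D`, `γ'' : C → A`, `δ' : D → F`,
> `α : A → F`] in which `α`, `β` are twin-primary with zero divisor in `𝔭`; the pre-steps
> `ζ := β ∘ γ : C → A`, `γ'' : C → A` are Div-equivalent [e.g., base-equivalent]. [Indeed, Definition
> 4.5, (ii) [cf. also the equivalences of categories of Definition 1.3, (iii), (d)], guarantees the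
> existence of base-equivalent pre-steps `ζ`, `γ''` — which may, moreover, be taken to be co-primary
> [cf. Proposition 4.1, (iii); Definition 2.4, (i), (c), (d)], by our assumption that `C_i` is of
> perfect type — such that `ζ` admits a factorization `β ∘ γ`, where `β` is primary with zero divisor
> that maps via `Φ(β)⁻¹` to an element of `𝔭`, and [again by our assumption that `C_i` is of perfect
> type] `𝔭` is not contained in the support of `(Φ(ζ))⁻¹(Div(γ))`.]"

PROOF-ONLY file (seat abc-iut-w5-d021, D-0068 sub-DAG S5 of L1, row `FrdI:Thm4.9/T49-L07`
`TwinPrimaryFromCartesianSquares`, EXISTENCE half; the converse half and the transport under `Ψ` are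
seat abc-iut-w4-d105's `TwinPrimarySquares` / `TwinPrimaryTransport`). For ONE Frobenioid `F : C → F_Φ` of
perfect and isotropic type with `Φ` perf-factorial, an object `A`, a prime `𝔭 ∈ Prime(Φ(A))`, and the
datum that Definition 4.5 (ii) provides at `𝔭` READ THROUGH THE TREE'S `Φ^birat` (`BiratSubfunctor.lean`,
`BiratGerms.lean`: the elements of `Φ^birat(A)` are the germs `Φ(δ₁)⁻¹Div δ₁ − Φ(δ₂)⁻¹Div δ₂` of
base-equivalent pairs of pre-steps `δ₁, δ₂ : Y → A`) — i.e. base-equivalent pre-steps `δ₁, δ₂ : Y → A`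
and `a, b ∈ Φ(A)` with `x_{δ₁} + b = x_{δ₂} + a`, `𝔭 ∈ Supp(a)`, `𝔭 ∉ Supp(b)` (support via divisibility
by elements of the subset `𝔭 ⊆ Φ(A)`) — we CONSTRUCT the seven arrows of the two displayed squares with
every property the converse half consumes: `α`, `β` primary steps, all arrows pre-steps, both squares
commutative and cartesian among pre-steps, `(δ, β)` and `(δ', α)` co-primary, `ζ = β ∘ γ` and `γ''`
Div-equivalent, and `Div(α) ∈ 𝔭` ("zero divisor in `𝔭`", as consumed by `FrdI.T49.TwinPrimaryCriterion`):
`PreFrobenioid.exists_twinPrimary_squares`. Route = the bracketed sentence: the monoid comparison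
`IsPerfFactorial.exists_primePart_of_mul_eq_mul` (`PerfFactorialPrimeParts.lean`) gives `x_{δ₁} = m + p + r`,
`x_{δ₂} = m + w`; `exists_baseEquivalent_of_dvd` (part 1, `Thm49TwinPrimaryLemmas.lean`) divides the pair
by `m` (Def. 1.3 (iii)(d), both slice and coslice, + total epimorphicity); `β`, `δ`, `γ`, `γ'`, `α`, `δ'` are
then realised by Def. 1.3 (iii)(d); cartesianness is `cartesian_of_invDiv_eq_mul` (part 1).
Also: `exists_twinPrimary_squares_of_mem_biratSubgroup` (hypothesis stated as membership
`a − b ∈ Φ^birat(A)`, i.e. literally the Def. 4.5 (ii) clause for THE birationalization datum, whose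
`phiBirat` is `biratSubgroup` by definition) and `exists_twinPrimary_squares_of_isStrictlyRational`
(hypothesis `PreFrobenioidData.IsStrictlyRational (biratData hF hsq) Supp A` for ANY support predicate
`Supp` obeying the support axiom "`𝔭 ∈ Supp(a)` iff some primary `a₀` of class `𝔭` is `≼ a`" — the shape
used by the S3 holder abc-iut-L6-t10 for the rational-type rows; the monoid bridge
`exists_mem_carrier_dvd_of_precsim` turns it into divisibility by an element of `𝔭`). Finally, in the
binders of row L06 (`FrdI.T49.TwinPrimaryCriterion`): `FrdI.T49.exists_twinPrimary_pair_of_isStrictlyRational`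
composes the existence with seat abc-iut-w4-d105's transport `isTwinPrimary_map_of_coprimary_squares`
(`TwinPrimaryTransport.lean`, row L08′) — in a `T42.Setting F₁ F₂ Ψ` with `Ψ` preserving primary pre-steps
and Div-equivalence, a strictly rational `A` has, at every `𝔭`, twin-primary steps `(α : A → F, β : B → A)`
with `Div(α) ∈ 𝔭` whose images under `Ψ` are twin-primary (p. 90 ll. 46–53). Nothing of [FrdI] is restated;
the typed statement of row L07 is `FrdI.T49.TwinPrimaryFromCartesianSquares` (`Thm49SubII.lean`); nothing here
bears on [IUTchIII] Cor. 3.12.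
-/

namespace Literature.AlgebraicGeometry.Frobenioids

open CategoryTheory Opposite

universe w v v' u u'

namespace PreFrobenioid

variable {D : Type u} [Category.{v} D] {Φ : Dᵒᵖ ⥤ CommMonCat.{w}}
  {C : Type u'} [Category.{v'} C] {F : C ⥤ ElemFrobenioid Φ}


/-! ### The existence theorem -/

/-- **[FrdI] proof of Thm. 4.9, p. 90 ll. 5–27 — existence of the twin-primary pair of Proposition 4.1
(iii) squares at `𝔭`.** Frobenioid of perfect and isotropic type, `Φ` perf-factorial; `A ∈ Ob(C)`,
`𝔭 ∈ Prime(Φ(A))`; DATUM (Def. 4.5 (ii) at `𝔭`, read through `Φ^birat(A) =` germs of base-equivalent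
pairs): base-equivalent pre-steps `δ₁, δ₂ : Y → A` and `a, b ∈ Φ(A)` with `x_{δ₁} + b = x_{δ₂} + a`,
some element of `𝔭` dividing `a`, none dividing `b`. CONCLUSION: objects `B, C, D, F` and pre-steps
`α : A → F`, `β : B → A`, `γ : C → B`, `γ' : C → D`, `δ : D → A`, `γ'' : C → A`, `δ' : D → F` with `α`, `β`
primary steps, `δ ∘ γ' = β ∘ γ`, `δ' ∘ γ' = α ∘ γ''`, both squares cartesian among pre-steps, `(δ, β)` and
`(δ', α)` co-primary, `β ∘ γ` and `γ''` Div-equivalent, and `Div(α) ∈ 𝔭` — so that `α`, `β` are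
twin-primary with zero divisor in `𝔭` by the converse half (abc-iut-w4-d105). [cite: MochizukiFrdI2008, Thm. 4.9 p.90] -/
theorem exists_twinPrimary_squares (hF : IsFrobenioid F) (hperf : IsOfPerfectType F)
    (histr : IsOfIsotropicType F) (hpf : Objectwise (fun M _ => IsPerfFactorial M) Φ)
    {Y A : C} {δ₁ δ₂ : Y ⟶ A} (h₁ : IsPreStep F δ₁) (h₂ : IsPreStep F δ₂) (hb : BaseEquivalent F δ₁ δ₂)
    (𝔭 : Primes (Φ.obj (op (baseObj F A)))) {a b : Φ.obj (op (baseObj F A))}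
    (hab : invDiv F δ₁ h₁.2 * b = invDiv F δ₂ h₂.2 * a) (ha : ∃ q ∈ 𝔭.carrier, q ∣ a)
    (hbf : ∀ q ∈ 𝔭.carrier, ¬ q ∣ b) :
    ∃ (B C' D' F' : C) (α : A ⟶ F') (β : B ⟶ A) (γ : C' ⟶ B) (γ' : C' ⟶ D') (δ : D' ⟶ A)
      (γ'' : C' ⟶ A) (δ' : D' ⟶ F'),
      IsStep F α ∧ IsPrimaryPreStep F α ∧ IsStep F β ∧ IsPrimaryPreStep F β ∧
      IsPreStep F γ ∧ IsPreStep F γ' ∧ IsPreStep F δ ∧ IsPreStep F γ'' ∧ IsPreStep F δ' ∧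
      γ' ≫ δ = γ ≫ β ∧ γ' ≫ δ' = γ'' ≫ α ∧
      (∀ ⦃V : C⦄ (a' : V ⟶ D') (b' : V ⟶ B), IsPreStep F a' → IsPreStep F b' → a' ≫ δ = b' ≫ β →
          ∃! u : V ⟶ C', u ≫ γ' = a' ∧ u ≫ γ = b') ∧
      (∀ ⦃V : C⦄ (a' : V ⟶ D') (b' : V ⟶ A), IsPreStep F a' → IsPreStep F b' → a' ≫ δ' = b' ≫ α →
          ∃! u : V ⟶ C', u ≫ γ' = a' ∧ u ≫ γ'' = b') ∧
      (∀ ⦃Z : C⦄ (ζ' : Z ⟶ A), IsPreStep F ζ' →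
          (∃ (ε' : D' ⟶ Z) (ι' : B ⟶ Z), IsPreStep F ε' ∧ IsPreStep F ι' ∧ ε' ≫ ζ' = δ ∧ ι' ≫ ζ' = β) →
            IsIso ζ') ∧
      (∀ ⦃Z : C⦄ (ζ' : Z ⟶ F'), IsPreStep F ζ' →
          (∃ (ε' : D' ⟶ Z) (ι' : A ⟶ Z), IsPreStep F ε' ∧ IsPreStep F ι' ∧ ε' ≫ ζ' = δ' ∧ ι' ≫ ζ' = α) →
            IsIso ζ') ∧
      DivEquivalent F (γ ≫ β) γ'' ∧ Div F α ∈ 𝔭.carrier := by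
  have hP := hF.isPreFrobenioid
  have hco : ∀ {X Z : C} {f : X ⟶ Z}, IsPreStep F f → IsCoAngularPreStep F f :=
    fun h => isCoAngularPreStep_of_isotropic histr h
  have hMA : IsPerfFactorial (Φ.obj (op (baseObj F A))) := hpf (baseObj F A)
  have hperfA : IsPerfect (Φ.obj (op (baseObj F A))) := isPerfect_divisorMonoid hF hperf A
  -- the monoid comparison: `x_{δ₁} = m + p + r`, `x_{δ₂} = m + w`
  obtain ⟨m, p, r, w, hx₁, hx₂, hp, hr, hw⟩ := hMA.exists_primePart_of_mul_eq_mul hperfA 𝔭 hab ha hbf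
  have hp1 : p ≠ 1 := hp.1.1
  -- divide out `m`: base-equivalent `ζ, γ'' : C' → A` with `x_ζ = p + r`, `x_{γ''} = w`
  obtain ⟨C', ζ, γ'', hζ, hγ'', hbζ, hxζ, hxγ''⟩ :=
    exists_baseEquivalent_of_dvd hF histr h₁ h₂ hb m (p * r) w hx₁ hx₂
  -- `β : B → A` realising `p`, `δ : D' → A` realising `r`; factor `ζ` through both
  obtain ⟨B, β, hβco, hxβ⟩ := hF.iii_d_over_surj A p
  obtain ⟨D', δ, hδco, hxδ⟩ := hF.iii_d_over_surj A r
  obtain ⟨γ, hγco, hγ⟩ := hF.iii_d_over_full ζ β (hco hζ) hβco (by rw [hxβ, hxζ]; exact Dvd.intro r rfl)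
  obtain ⟨γ', hγ'co, hγ'⟩ := hF.iii_d_over_full ζ δ (hco hζ) hδco
    (by rw [hxδ, hxζ]; exact Dvd.intro_left p rfl)
  -- `α : A → F'` with `Div α = p`; `δ' : D' → F'` with `δ' ∘ γ' = α ∘ γ''`
  obtain ⟨F', α, hαco, hDα⟩ := hF.iii_d_under_surj A p
  have hDγ' : Div F γ' = pull Φ (Base F ζ) p :=
    div_eq_pull_of_comp_eq hP hγ'co.2 hδco.2 hζ hγ' p (by rw [hxζ, hxδ])
  have hγ''α : IsPreStep F (γ'' ≫ α) := IsPreStep.comp F hγ'' hαco.2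
  obtain ⟨δ', hδ'co, hδ'⟩ := hF.iii_d_under_full γ' (γ'' ≫ α) hγ'co (hco hγ''α) (by
    rw [hDγ', div_comp_of_isLinear γ'' hαco.2.1, hDα, show Base F ζ = Base F γ'' from hbζ]
    exact Dvd.intro _ rfl)
  -- the isomorphisms `Φ(Base ·)` in play
  haveI : IsIso (Base F α) := hαco.2.2
  haveI : IsIso (Base F β) := hβco.2.2
  haveI : IsIso (Base F δ) := hδco.2.2
  haveI : IsIso (Base F δ') := hδ'co.2.2
  haveI : IsIso (Base F γ') := hγ'co.2.2
  haveI : IsIso (Base F ζ) := hζ.2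
  haveI : IsCancelMul (Φ.obj (op (baseObj F D'))) :=
    isIntegral_iff_isCancelMul.mp (hP.isDivisorial (baseObj F D')).isPreDivisorial.isIntegral
  -- `x_α = Φ(α)⁻¹(p)`, `x_{α ∘ γ''} = Φ(α)⁻¹(p + w)`, `Base(δ') = Base(α) ∘ Base(δ)`, `x_{δ'} = Φ(α)⁻¹(w)`
  have hxα : invDiv F α hαco.2.2 = pull Φ (inv (Base F α)) p := by
    show pull Φ (inv (Base F α)) (Div F α) = _
    rw [hDα]
  have hxγ''α : invDiv F (γ'' ≫ α) hγ''α.2 = pull Φ (inv (Base F α)) (p * w) := by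
    apply pull_injective (Base F α)
    rw [pull_invDiv_comp F γ'' α hγ''.2 hαco.2 hγ''α.2, hDα, hxγ'', pull_pull_inv_eq]
  have hBδ' : Base F δ' = Base F δ ≫ Base F α := by
    apply (cancel_epi (Base F γ')).mp
    rw [← base_comp F γ' δ', hδ', ← Category.assoc, ← base_comp F γ' δ, hγ', base_comp,
      show Base F ζ = Base F γ'' from hbζ]
  have hxδ' : invDiv F δ' hδ'co.2.2 = pull Φ (inv (Base F α)) w := by
    have h1 : pull Φ (Base F δ') (invDiv F (γ' ≫ δ') (hδ' ▸ hγ''α.2)) = Div F δ' * invDiv F γ' hγ'co.2.2 :=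
      pull_invDiv_comp F γ' δ' hγ'co.2.2 hδ'co.2 _
    have h2 : invDiv F (γ' ≫ δ') (hδ' ▸ hγ''α.2) = invDiv F (γ'' ≫ α) hγ''α.2 := by
      congr 1
    have h3 : invDiv F γ' hγ'co.2.2 = pull Φ (Base F δ) p := by
      apply pull_injective (Base F γ')
      rw [pull_invDiv, ← pull_comp, ← base_comp, hγ', hDγ']
    rw [h2, hxγ''α, h3, ← pull_invDiv δ' hδ'co.2.2, hBδ', pull_comp, pull_comp, pull_pull_inv_eq,
      map_mul] at h1
    -- `h1 : Φ(δ)(p) · Φ(δ)(w) = Φ(δ)(Φ(α)(x_{δ'})) · Φ(δ)(p)`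
    have h4 : pull Φ (Base F δ) w = pull Φ (Base F δ) (pull Φ (Base F α) (invDiv F δ' hδ'co.2.2)) :=
      mul_left_cancel (h1.trans (mul_comm _ _))
    have h5 : pull Φ (Base F α) (invDiv F δ' hδ'co.2.2) = w := (pull_injective (Base F δ) h4).symm
    rw [← h5, pull_inv_pull_eq]
  -- co-primarity in the language of monoids: `(r, p)` over `A`, `(Φ(α)⁻¹ w, Φ(α)⁻¹ p)` over `F'`
  have hcopA : ∀ x, x ∣ invDiv F δ hδco.2.2 → x ∣ invDiv F β hβco.2.2 → x = 1 := by
    rw [hxδ, hxβ]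
    exact forall_common_dvd_eq_one_of_mem_carrier 𝔭 hp hr
  obtain ⟨e, he⟩ := exists_mulEquiv_pull (Φ := Φ) (inv (Base F α))
  have hcopF : ∀ x, x ∣ invDiv F δ' hδ'co.2.2 → x ∣ invDiv F α hαco.2.2 → x = 1 := by
    rw [hxδ', hxα, ← he, ← he]
    exact forall_common_dvd_eq_one_map_mulEquiv e (forall_common_dvd_eq_one_of_mem_carrier 𝔭 hp hw)
  have hMF : IsPerfFactorial (Φ.obj (op (baseObj F F'))) := hpf (baseObj F F')
  have hperfF : IsPerfect (Φ.obj (op (baseObj F F'))) := isPerfect_divisorMonoid hF hperf F'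
  refine ⟨B, C', D', F', α, β, γ, γ', δ, γ'', δ', ?_, ?_, ?_, ?_, hγco.2, hγ'co.2, hδco.2, hγ'', hδ'co.2,
    by rw [hγ', hγ], hδ', ?_, ?_, ?_, ?_, ?_, ?_⟩
  · -- `α` is a step: `Div α = p ≠ 0`
    refine ⟨hαco.2, fun hiso => hp1 ?_⟩
    rw [← hDα]
    exact isIsometry_of_isIso F hP α
  · -- `α` is primary
    exact ⟨hαco.2, by rw [hDα]; exact hp.1⟩
  · -- `β` is a step: `x_β = p ≠ 0`
    refine ⟨hβco.2, fun hiso => hp1 ?_⟩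
    rw [← hxβ]
    exact invDiv_eq_one_of_isIso hP β hβco.2.2
  · -- `β` is primary: `Div β = Φ(β)(p)`
    refine ⟨hβco.2, ?_⟩
    rw [← pull_invDiv β hβco.2.2, hxβ]
    exact (isPrimary_pull_iff _ _).mpr hp.1
  · -- square 1 is cartesian among pre-steps: `ζ` realises `x_δ + x_β = r + p`
    exact cartesian_of_invDiv_eq_mul hF histr hδco.2 hβco.2
      (fun c hc₁ hc₂ => hMA.mul_dvd_of_forall_common_dvd_eq_one hperfA hcopA hc₁ hc₂) hζ
      (by rw [hxζ, hxδ, hxβ, mul_comm]) hγ'co.2 hγ' hγ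
  · -- square 2 is cartesian among pre-steps: `α ∘ γ''` realises `x_{δ'} + x_α`
    exact cartesian_of_invDiv_eq_mul hF histr hδ'co.2 hαco.2
      (fun c hc₁ hc₂ => hMF.mul_dvd_of_forall_common_dvd_eq_one hperfF hcopF hc₁ hc₂) hγ''α
      (by rw [hxγ''α, hxδ', hxα, map_mul, mul_comm]) hγ'co.2 hδ' rfl
  · -- `(δ, β)` co-primary
    exact (isCoprimary_iff_forall_dvd hF histr hδco.2 hβco.2).mpr hcopA
  · -- `(δ', α)` co-primary
    exact (isCoprimary_iff_forall_dvd hF histr hδ'co.2 hαco.2).mpr hcopF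
  · -- `ζ = β ∘ γ` and `γ''` are base-equivalent, hence Div-equivalent
    show pull Φ (Base F (γ ≫ β)) = pull Φ (Base F γ'')
    rw [hγ, show Base F ζ = Base F γ'' from hbζ]
  · -- zero divisor of `α` in `𝔭`
    rw [hDα]
    exact hp

/-! ### The same, with the hypothesis literally the clause of Definition 4.5 (ii) for `Φ^birat` -/

/-- **[FrdI] proof of Thm. 4.9, p. 90 ll. 5–27, from the Def. 4.5 (ii) clause at `𝔭`:** if
`a − b ∈ Φ^birat(A)` (`biratSubgroup`, = the `phiBirat` of THE birationalization datum `biratData`) with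
some element of `𝔭` dividing `a` and none dividing `b`, then the twin-primary pair of Prop. 4.1 (iii)
squares at `𝔭` of `exists_twinPrimary_squares` exists (the germ reading of `Φ^birat(A)`,
`mem_biratGerms_of_mem_biratSubfunctor`, supplies the base-equivalent pair `δ₁, δ₂`).
[cite: MochizukiFrdI2008, Thm. 4.9 p.90] -/
theorem exists_twinPrimary_squares_of_mem_biratSubgroup (hF : IsFrobenioid F) (hperf : IsOfPerfectType F)
    (histr : IsOfIsotropicType F) (hpf : Objectwise (fun M _ => IsPerfFactorial M) Φ) (A : C)
    (𝔭 : Primes (Φ.obj (op (baseObj F A)))) {a b : Φ.obj (op (baseObj F A))}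
    (hmem : Algebra.GrothendieckGroup.of a / Algebra.GrothendieckGroup.of b ∈ biratSubgroup F (baseObj F A))
    (ha : ∃ q ∈ 𝔭.carrier, q ∣ a) (hbf : ∀ q ∈ 𝔭.carrier, ¬ q ∣ b) :
    ∃ (B C' D' F' : C) (α : A ⟶ F') (β : B ⟶ A) (γ : C' ⟶ B) (γ' : C' ⟶ D') (δ : D' ⟶ A)
      (γ'' : C' ⟶ A) (δ' : D' ⟶ F'),
      IsStep F α ∧ IsPrimaryPreStep F α ∧ IsStep F β ∧ IsPrimaryPreStep F β ∧
      IsPreStep F γ ∧ IsPreStep F γ' ∧ IsPreStep F δ ∧ IsPreStep F γ'' ∧ IsPreStep F δ' ∧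
      γ' ≫ δ = γ ≫ β ∧ γ' ≫ δ' = γ'' ≫ α ∧
      (∀ ⦃V : C⦄ (a' : V ⟶ D') (b' : V ⟶ B), IsPreStep F a' → IsPreStep F b' → a' ≫ δ = b' ≫ β →
          ∃! u : V ⟶ C', u ≫ γ' = a' ∧ u ≫ γ = b') ∧
      (∀ ⦃V : C⦄ (a' : V ⟶ D') (b' : V ⟶ A), IsPreStep F a' → IsPreStep F b' → a' ≫ δ' = b' ≫ α →
          ∃! u : V ⟶ C', u ≫ γ' = a' ∧ u ≫ γ'' = b') ∧
      (∀ ⦃Z : C⦄ (ζ' : Z ⟶ A), IsPreStep F ζ' →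
          (∃ (ε' : D' ⟶ Z) (ι' : B ⟶ Z), IsPreStep F ε' ∧ IsPreStep F ι' ∧ ε' ≫ ζ' = δ ∧ ι' ≫ ζ' = β) →
            IsIso ζ') ∧
      (∀ ⦃Z : C⦄ (ζ' : Z ⟶ F'), IsPreStep F ζ' →
          (∃ (ε' : D' ⟶ Z) (ι' : A ⟶ Z), IsPreStep F ε' ∧ IsPreStep F ι' ∧ ε' ≫ ζ' = δ' ∧ ι' ≫ ζ' = α) →
            IsIso ζ') ∧
      DivEquivalent F (γ ≫ β) γ'' ∧ Div F α ∈ 𝔭.carrier := by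
  have hP := hF.isPreFrobenioid
  -- the germ reading of `Φ^birat(A)`
  obtain ⟨Y, δ₁, δ₂, hδ₁, hδ₂, hb, hd⟩ := mem_biratGerms_of_mem_biratSubfunctor F hF histr hmem
  -- `of a / of b = of x₁ / of x₂` in `Φ(A)^gp` ⇒ `x₁ · b = x₂ · a` in the integral monoid `Φ(A)`
  have hinj : Function.Injective (Algebra.GrothendieckGroup.of (M := Φ.obj (op (baseObj F A)))) :=
    (hP.isDivisorial (baseObj F A)).isPreDivisorial.isIntegral.injective_of
  have hab : invDiv F δ₁ hδ₁.2.2 * b = invDiv F δ₂ hδ₂.2 * a := by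
    apply hinj
    rw [map_mul, map_mul]
    rw [div_eq_div_iff_mul_eq_mul] at hd
    rw [mul_comm] at hd
    exact hd.symm
  exact exists_twinPrimary_squares hF hperf histr hpf hδ₁.2 hδ₂ hb 𝔭 hab ha hbf

/-- **[FrdI] proof of Thm. 4.9, p. 90 ll. 5–27, from Definition 4.5 (ii) as typed** (`IsStrictlyRational`
of `DivisorMonoidCategoryTheoreticityDefs.lean` at THE birationalization datum `biratData hF hsq`, for any
support predicate `Supp` obeying the support axiom of Def. 2.4 (i)(d): "`𝔭 ∈ Supp(a)` iff some primary
`a₀` of class `𝔭` is `≼ a`"): a strictly rational object `A` of a Frobenioid of perfect and isotropic type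
with `Φ` perf-factorial carries, at every prime `𝔭 ∈ Prime(Φ(A))`, the twin-primary pair of Prop. 4.1 (iii)
squares of `exists_twinPrimary_squares`. [cite: MochizukiFrdI2008, Thm. 4.9 p.90] -/
theorem exists_twinPrimary_squares_of_isStrictlyRational (hF : IsFrobenioid F) (hsq : HasBiratSquares F)
    (hperf : IsOfPerfectType F) (histr : IsOfIsotropicType F)
    (hpf : Objectwise (fun M _ => IsPerfFactorial M) Φ)
    (Supp : ∀ {X : D}, (PreFrobenioidData.ofFunctor Φ F).Mon X →
      Primes ((PreFrobenioidData.ofFunctor Φ F).Mon X) → Prop)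
    (hSupp : ∀ (X : D) (a : Φ.obj (op X)) (𝔭 : Primes (Φ.obj (op X))),
      Supp a 𝔭 ↔ ∃ (a₀ : Φ.obj (op X)) (h₀ : IsPrimary a₀),
        Quotient.mk (primarySetoid _) ⟨a₀, h₀⟩ = 𝔭 ∧ Precsim a₀ a)
    {A : C} (hA : PreFrobenioidData.IsStrictlyRational (biratData hF hsq) Supp A)
    (𝔭 : Primes (Φ.obj (op (baseObj F A)))) :
    ∃ (B C' D' F' : C) (α : A ⟶ F') (β : B ⟶ A) (γ : C' ⟶ B) (γ' : C' ⟶ D') (δ : D' ⟶ A)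
      (γ'' : C' ⟶ A) (δ' : D' ⟶ F'),
      IsStep F α ∧ IsPrimaryPreStep F α ∧ IsStep F β ∧ IsPrimaryPreStep F β ∧
      IsPreStep F γ ∧ IsPreStep F γ' ∧ IsPreStep F δ ∧ IsPreStep F γ'' ∧ IsPreStep F δ' ∧
      γ' ≫ δ = γ ≫ β ∧ γ' ≫ δ' = γ'' ≫ α ∧
      (∀ ⦃V : C⦄ (a' : V ⟶ D') (b' : V ⟶ B), IsPreStep F a' → IsPreStep F b' → a' ≫ δ = b' ≫ β →
          ∃! u : V ⟶ C', u ≫ γ' = a' ∧ u ≫ γ = b') ∧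
      (∀ ⦃V : C⦄ (a' : V ⟶ D') (b' : V ⟶ A), IsPreStep F a' → IsPreStep F b' → a' ≫ δ' = b' ≫ α →
          ∃! u : V ⟶ C', u ≫ γ' = a' ∧ u ≫ γ'' = b') ∧
      (∀ ⦃Z : C⦄ (ζ' : Z ⟶ A), IsPreStep F ζ' →
          (∃ (ε' : D' ⟶ Z) (ι' : B ⟶ Z), IsPreStep F ε' ∧ IsPreStep F ι' ∧ ε' ≫ ζ' = δ ∧ ι' ≫ ζ' = β) →
            IsIso ζ') ∧
      (∀ ⦃Z : C⦄ (ζ' : Z ⟶ F'), IsPreStep F ζ' →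
          (∃ (ε' : D' ⟶ Z) (ι' : A ⟶ Z), IsPreStep F ε' ∧ IsPreStep F ι' ∧ ε' ≫ ζ' = δ' ∧ ι' ≫ ζ' = α) →
            IsIso ζ') ∧
      DivEquivalent F (γ ≫ β) γ'' ∧ Div F α ∈ 𝔭.carrier := by
  obtain ⟨a, b, hmem, hSa, hSb⟩ := hA 𝔭
  have hMA : IsPerfFactorial (Φ.obj (op (baseObj F A))) := hpf (baseObj F A)
  have hperfA : IsPerfect (Φ.obj (op (baseObj F A))) := isPerfect_divisorMonoid hF hperf A
  obtain ⟨a₀, h₀, h𝔭, hpre⟩ := (hSupp _ a 𝔭).mp hSa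
  have ha : ∃ q ∈ 𝔭.carrier, q ∣ a := hMA.exists_mem_carrier_dvd_of_precsim hperfA 𝔭 ⟨h₀, h𝔭⟩ hpre
  have hbf : ∀ q ∈ 𝔭.carrier, ¬ q ∣ b :=
    primeFree_of_not_exists_precsim 𝔭 fun h => hSb ((hSupp _ b 𝔭).mpr h)
  exact exists_twinPrimary_squares_of_mem_biratSubgroup hF hperf histr hpf A 𝔭 hmem ha hbf

end PreFrobenioid

/-! ### In the binders of row L06 (`TwinPrimaryCriterion`): existence composed with the transport under `Ψ` -/

namespace FrdI.T49

variable {D₁ : Type u} [Category.{v} D₁] {Φ₁ : D₁ᵒᵖ ⥤ CommMonCat.{w}} {C₁ : Type u'} [Category.{v'} C₁]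
  {D₂ : Type u} [Category.{v} D₂] {Φ₂ : D₂ᵒᵖ ⥤ CommMonCat.{w}} {C₂ : Type u'} [Category.{v'} C₂]
  {F₁ : C₁ ⥤ ElemFrobenioid Φ₁} {F₂ : C₂ ⥤ ElemFrobenioid Φ₂} {Ψ : C₁ ≌ C₂}

/-- **[FrdI] proof of Thm. 4.9, p. 90 ll. 5–53 at a strictly rational object**: in a `T42.Setting F₁ F₂ Ψ`
("after passing to perfections"), with `Ψ` preserving primary pre-steps (Thm. 4.2 (i)) and Div-equivalent
pairs of base-isomorphisms (Thm. 4.2 (ii); `Φ_i` non-dilating), a STRICTLY RATIONAL object `A` of `C₁`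
(Def. 4.5 (ii) at THE birationalization of `F₁`, any support predicate obeying the support axiom) admits,
"for each `𝔭 ∈ Prime(Φ₁(A))`, … twin-primary steps with zero divisor in `𝔭` that are mapped by `Ψ` to
twin-primary steps of `C₂`" — existence (this file) composed with the transport
`isTwinPrimary_map_of_coprimary_squares` (seat abc-iut-w4-d105); the output is literally the last hypothesis
of `FrdI.T49.TwinPrimaryCriterion`. [cite: MochizukiFrdI2008, Thm. 4.9 p.90] -/
theorem exists_twinPrimary_pair_of_isStrictlyRational (hS : T42.Setting F₁ F₂ Ψ)
    (hprim : ∀ ⦃X Y : C₁⦄ (φ : X ⟶ Y), PreFrobenioid.IsPrimaryPreStep F₁ φ →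
      PreFrobenioid.IsPrimaryPreStep F₂ (Ψ.functor.map φ))
    (hdiveq : ∀ ⦃X Y : C₁⦄ (φ ψ : X ⟶ Y), PreFrobenioid.IsBaseIso F₁ φ → PreFrobenioid.IsBaseIso F₁ ψ →
      PreFrobenioid.DivEquivalent F₁ φ ψ →
        PreFrobenioid.DivEquivalent F₂ (Ψ.functor.map φ) (Ψ.functor.map ψ))
    (hsq : PreFrobenioid.HasBiratSquares F₁)
    (Supp : ∀ {X : D₁}, (PreFrobenioidData.ofFunctor Φ₁ F₁).Mon X →
      Primes ((PreFrobenioidData.ofFunctor Φ₁ F₁).Mon X) → Prop)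
    (hSupp : ∀ (X : D₁) (a : Φ₁.obj (op X)) (𝔭 : Primes (Φ₁.obj (op X))),
      Supp a 𝔭 ↔ ∃ (a₀ : Φ₁.obj (op X)) (h₀ : IsPrimary a₀),
        Quotient.mk (primarySetoid _) ⟨a₀, h₀⟩ = 𝔭 ∧ Precsim a₀ a)
    {A : C₁} (hA : PreFrobenioidData.IsStrictlyRational (PreFrobenioid.biratData hS.isFrobenioid₁ hsq) Supp A)
    (𝔭 : Primes (Φ₁.obj (op (PreFrobenioid.baseObj F₁ A)))) :
    ∃ (B C' : C₁) (β : A ⟶ B) (γ : C' ⟶ A), IsTwinPrimary F₁ β γ ∧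
      PreFrobenioid.Div F₁ β ∈ 𝔭.carrier ∧ IsTwinPrimary F₂ (Ψ.functor.map β) (Ψ.functor.map γ) := by
  obtain ⟨B, C', D', F', α, β, γ, γ', δ, γ'', δ', hα, hαp, hβ, hβp, hγ, hγ', hδ, hγ'', hδ', sq₁, sq₂,
    cart₁, cart₂, cop₁, cop₂, hde, hDα⟩ :=
    PreFrobenioid.exists_twinPrimary_squares_of_isStrictlyRational hS.isFrobenioid₁ hsq hS.perfect₁
      hS.isotropic₁ hS.perfFactorial₁ Supp hSupp hA 𝔭
  obtain ⟨h₁, h₂⟩ := isTwinPrimary_map_of_coprimary_squares F₁ F₂ Ψ hS hprim hdiveq α β γ γ' δ γ'' δ'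
    hα hαp hβ hβp hγ hγ' hδ hγ'' hδ' sq₁ sq₂ cart₁ cart₂ cop₁ cop₂ hde
  exact ⟨F', B, α, β, h₁, hDα, h₂⟩

end FrdI.T49

end Literature.AlgebraicGeometry.Frobenioids
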